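import Summits.HubbardSuperconductivity.HubbardSuperconductivity.Theorems.AnisotropyChordTransferFibre3N1RowCellSound
import Summits.HubbardSuperconductivity.HubbardSuperconductivity.Theorems.AnisotropyChordTransferFibre3N1RowCheckS

/-!
# Route `AnisotropyChord` / H0 rotor rung, LEVEL 2 row `N₁`: ★★★ a passing FIRST-ORDER cell check bounds the trial gap for ALL `L ≥ 128`

The composition of the first-order (slope) cell certificate with the Level-2 `N₁` pipeline of `…N1RowCellSound`: the interval
layer is abstracted into the CORE BOUND `CoreBound c a₁ a₂ cmin` (for every real vector in the cell box satisfying the staged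
specs and every bracketed object list: `1 ≤ P̂`, `1 ≤ U′`, `cmin·U′ ≤ N₁′` at the final vector) — ★ `trialGap_of_coreBound` is the
argument of `trialGap_of_cellCheck` verbatim with that hypothesis; the zero-order checker gives it by `n1CellCheckC_sound`
(`coreBound_of_cellCheckC`) and the first-order checker of `…N1RowCheckS` by `cellCheckS_sound` (`coreBound_of_cellCheckS`); whence
★★★ `trialGap_of_cellCheckS2`: ten passing END CHECKS (literal slope data of the bracket ends `B̂∓, P̂∓, Â∓, Q̂₁∓, Ĵ₁∓`) and a
passing FINAL CHECK on the column `c` give, for EVERY `L ≥ 128` and EVERY ground two-magnon profile (`0 ≤ Δ < 1`) with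
`ν = λ₂/θ² ∈ [n₁/νd, n₂/νd]`, `a = Δf(x̂) ∈ [a₁, a₂]`:  `cmin · U ≤ N₁`.
Prover seat `hubbard-h0-rotor-p2` g6; helper for piece A = stmt-HubbardSuperconductivity-23918 of rung 19089
(`--supports`, helper class).  WHAT THIS IS NOT: nothing here proves superconductivity in the Hubbard model, nor the crux itself: it
reduces `TrialGapAbs L Δ cmin` for all `L ≥ 128` on a `(ν, a)`-cell to eleven kernel checks; the rotor TARGET as originally worded
stays FALSE (g15 verdict).  Mathlib + the tree only; no sorry.
-/

set_option linter.dupNamespace false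
set_option autoImplicit false

open Literature.Analysis.ValidatedNumerics

namespace Summit.HubbardSuperconductivity.HubbardSuperconductivity.Theorems.AnisotropyChord.Transfer.Fibre3.L2.N1

open Summit.HubbardSuperconductivity.HubbardSuperconductivity.Theorems.AnisotropyChord.Transfer.Fibre3.L2

/-- ★ THE CORE BOUND of a cell: the conclusion of the interval layer (`n1CellCheckC_sound` / `cellCheckS_sound`) as a
proposition about the cell `(c, a₁, a₂)` and the constant `cmin` (block size `M₂ = 2`). -/
def CoreBound (c : L2.NamedCell) (a1 a2 cmin : ℚ) : Prop :=
  ∀ (X : ℕ → ℝ), PMem (c.box a1 a2) X →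
    (∀ j (hj : j < (specs 2).length), ((specs 2)[j].1).eval X ≤ X (16 + j) ∧ X (16 + j) ≤ ((specs 2)[j].2).eval X) →
    ∀ (vs : List ℝ), vs.length = 5 →
    (∀ j (hj : j < (objSpecsC 2).length) (hj' : j < vs.length),
      ((objSpecsC 2)[j].1).eval X ≤ vs[j] ∧ vs[j] ≤ ((objSpecsC 2)[j].2).eval X) →
    1 ≤ finalVec X vs 6 ∧ 1 ≤ UpE.eval (finalVec X vs) ∧ (cmin : ℝ) * UpE.eval (finalVec X vs) ≤ N1pE.eval (finalVec X vs)

/-- the zero-order checker gives the core bound. -/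
theorem coreBound_of_cellCheckC {c : L2.NamedCell} {a1 a2 cmin : ℚ} {pi : ℕ × ℕ}
    (hchk : n1CellCheckC c a1 a2 2 cmin pi = true) : CoreBound c a1 a2 cmin :=
  fun X hX hsp vs hvl hob => n1CellCheckC_sound c a1 a2 2 cmin pi hchk specsVarsOkC_two X hX hsp vs hvl hob

/-- ★ the first-order checker (end checks + final check) gives the core bound. -/
theorem coreBound_of_cellCheckS {c : L2.NamedCell} {a1 a2 cmin : ℚ} {pi : ℕ × ℕ} (ends : List (SD × SD))
    (hlen : ends.length = (objSpecsC 2).length)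
    (hends : ∀ j (hj : j < (objSpecsC 2).length) (hj' : j < ends.length),
      EndHolds c a1 a2 2 pi ((objSpecsC 2)[j].1) (ends[j].1) ∧ EndHolds c a1 a2 2 pi ((objSpecsC 2)[j].2) (ends[j].2))
    (hfin : finalCheckS c a1 a2 2 pi ends cmin = true) : CoreBound c a1 a2 cmin :=
  fun X hX hsp vs hvl hob => cellCheckS_sound c a1 a2 2 cmin pi ends hlen hends hfin specsVarsOkC_two X hX hsp vs hvl hob

variable (L : ℕ) [NeZero L]

/-- ★★★ **A CORE BOUND ON THE CELL GIVES THE TRIAL-GAP BOUND FOR EVERY `L ≥ 128` ON THE CELL** (the argument of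
`trialGap_of_cellCheck`, verbatim, with the interval layer abstracted into the hypothesis `hcore`). -/
theorem trialGap_of_coreBound (c : L2.NamedCell) (a1 a2 cmin : ℚ)
    (hcore : CoreBound c a1 a2 cmin) (hc : c.check = true) (hL : 128 ≤ L)
    {Δ lam2 : ℝ} {f : Tor L → ℝ} (hΔ0 : 0 ≤ Δ) (hΔ1 : Δ < 1) (hf : IsGroundTwoMagnon L Δ lam2 f)
    (hν1 : (c.n1 : ℝ) / c.νd ≤ lam2 / (2 * Real.pi / L) ^ 2) (hν2 : lam2 / (2 * Real.pi / L) ^ 2 ≤ (c.n2 : ℝ) / c.νd)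
    (ha1 : ((a1 : ℚ) : ℝ) ≤ Δ * f (K1 L)) (ha2 : Δ * f (K1 L) ≤ ((a2 : ℚ) : ℝ)) :
    (cmin : ℝ) * Uunit L Δ f ≤ trialGapN1 L Δ f := by
  classical
  set X := xTrue L Δ lam2 f (Δ * f (K1 L)) with hXdef
  set θ : ℝ := 2 * Real.pi / L with hθ
  have hLpos : (0 : ℝ) < L := by exact_mod_cast (show 0 < L by omega)
  have hπ := Real.pi_pos
  have hθpos : 0 < θ := by positivity
  have ht0 : 0 < θ ^ 2 := by positivity
  -- regime facts
  have hlam : 0 < lam2 := lam2_pos L (by omega) hΔ1 hf.1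
  have h2 : 2 * lam2 < eps1 L := two_lam2_lt_eps1 L (by omega) hΔ0 hf
  obtain ⟨ha0, haV, _, _⟩ := ManifoldA.manifold_band L hL hΔ0 hΔ1 hf
  have hνc := ManifoldA.nu_ceiling L hL hΔ0 hf
  have hν4 : lam2 / (2 * Real.pi / L) ^ 2 < 4 / Real.pi ^ 2 := by
    rw [div_lt_iff₀ ht0]
    have hπ2 : Real.pi ^ 2 < 10 := by nlinarith [Real.pi_lt_d2, Real.pi_pos]
    have : (0.031 : ℝ) ≤ 4 / Real.pi ^ 2 := by rw [le_div_iff₀ (by positivity)]; nlinarith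
    nlinarith
  have hV1 : (1 : ℝ) / (L : ℝ) ^ 2 = θ ^ 2 * (4 * Real.pi ^ 2)⁻¹ := by
    rw [hθ]; field_simp; ring
  have hu' : 0 < 1 - Δ * f (K1 L) + Δ * f (K1 L) * ((2 * Real.pi / L) ^ 2 * (4 * Real.pi ^ 2)⁻¹) := by
    rw [← hθ, ← hV1]; nlinarith
  obtain ⟨_, _, d3, _, d5, _, d7⟩ := ManifoldA.manifold_dictionary L (by omega) hΔ0 hΔ1 hf
  have hu : 0 < cS L Δ lam2 f * Gzero L lam2 := by
    rw [← Gres_zero_zero_eq_Gzero, d5]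
    have : 1 - Δ * f (K1 L) + Δ * f (K1 L) / (L : ℝ) ^ 2
        = 1 - Δ * f (K1 L) + Δ * f (K1 L) * ((2 * Real.pi / L) ^ 2 * (4 * Real.pi ^ 2)⁻¹) := by
      rw [← hθ, ← hV1]; ring
    rw [this]; exact hu'
  -- the interval layer
  have hPM : PMem (c.box a1 a2) X := pmem_xTrue c hc a1 a2 L hL Δ lam2 f _ hν1 hν2 ha1 ha2
  have hsp := xTrue_specs_ground L Δ lam2 f (by omega) hΔ0 hΔ1 hf hlam h2 hν4 ha0 hu'
  set vB : ℝ := ((2 * Real.pi / L) ^ 2) ^ 3 * ∑ k : Tor L, F2 L f k ^ 2 * F2 L f (k + K1 L) with hvB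
  set vP : ℝ := ((2 * Real.pi / L) ^ 2) ^ 3 * ∑ k : Tor L, F2 L f k ^ 3 with hvP
  set vA : ℝ := ((2 * Real.pi / L) ^ 2) ^ 2 * ∑ k : Tor L, F2 L f k ^ 2 * cosx L k with hvA
  set vQ : ℝ := ((2 * Real.pi / L) ^ 2) ^ 2 * ∑ k : Tor L, nK L f k * F2 L f k with hvQ
  set vJ : ℝ := ((2 * Real.pi / L) ^ 2) ^ 2 * ∑ k : Tor L, bcJ L f k with hvJ
  have oB := bHat_mem L Δ lam2 f (by omega) hΔ0 hΔ1 hf hlam h2 hu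
  have oP := pHat_mem L Δ lam2 f (by omega) hΔ0 hΔ1 hf hlam h2 hu
  have oA := aHat_mem L Δ lam2 f (by omega) hΔ0 hΔ1 hf hlam h2 hu
  have oQ := q1Hat_mem L Δ lam2 f (by omega) hΔ0 hΔ1 hf hlam h2 hu
  have oJ := j1Hat_mem L Δ lam2 f (by omega) hΔ0 hΔ1 hf hlam h2 hu
  have hob : ∀ j (hj : j < (objSpecsC 2).length) (hj' : j < [vB, vP, vA, vQ, vJ].length),
      ((objSpecsC 2)[j].1).eval X ≤ [vB, vP, vA, vQ, vJ][j] ∧ [vB, vP, vA, vQ, vJ][j] ≤ ((objSpecsC 2)[j].2).eval X := by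
    intro j hj hj'
    have hj5 : j < 5 := by simpa [objSpecsC] using hj
    interval_cases j
    · simpa [objSpecsC] using oB
    · simpa [objSpecsC] using oP
    · simpa [objSpecsC] using oA
    · simpa [objSpecsC] using oQ
    · simpa [objSpecsC] using oJ
  obtain ⟨hP1, hU1, hM⟩ := hcore X hPM hsp [vB, vP, vA, vQ, vJ] rfl hob
  obtain ⟨y0, y1, y2, y3, y4, y5, y6, y7, y8, y9⟩ := finalVec_vals X vB vP vA vQ vJ
  set y := finalVec X [vB, vP, vA, vQ, vJ] with hy
  -- coordinates of `X`
  have hX0 : X 0 = θ ^ 2 := xTrue_zero L Δ lam2 f _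
  have hX1 : X 1 = Real.pi ^ 2 := by rw [hXdef, xTrue_lt16 L Δ lam2 f _ (by norm_num)]; rfl
  have hX2 : X 2 = lam2 / θ ^ 2 := by rw [hXdef, xTrue_lt16 L Δ lam2 f _ (by norm_num)]; rfl
  have hX3 : X 3 = Δ * f (K1 L) := by rw [hXdef, xTrue_lt16 L Δ lam2 f _ (by norm_num)]; rfl
  have hX16 : X 16 = eps1 L / θ ^ 2 := by rw [hXdef, xTrue_16]; rfl
  rw [y6] at hP1
  have hvP0 : 0 < vP := by linarith
  -- the assembly expressions at `y`
  have eN : N1pE.eval y = -(6 * y 4 * y 5) + 9 * y 8 * y 5 * (y 6)⁻¹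
      - 1 / 2 * y 4 * y 0 * (3 * y 2 * y 6 + -(3 / 2 * y 8) + 12 * (y 3 * (y 3 + y 1 * y 2)) * y 7) - 3 * y 9 := by
    simp only [N1pE, rsum, RExpr.eval, cst, fE1, fB, fQ, fP, fT, fNu, fA, fPi2, fAx, fJ]; push_cast; ring
  have eU : UpE.eval y = 192 * (y 1) ^ 3 * (3 * y 2 - 3 / 2 * y 8 * (y 6)⁻¹) := by
    simp only [UpE, cube, RExpr.eval, cst, fPi2, fNu, fQ, fP]; push_cast; ring
  -- the true `N₁` and `U`
  have heven : ∀ r : Tor L, f (-r) = f r := hf.2.1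
  have hswap : ∀ r : Tor L, f (r.2, r.1) = f r := ground_swap L (by omega) hf
  have hN1 := n1Identity_holds L Δ lam2 f hf.1
  have hG2 := g2OneLoopForm_holds L (by omega) Δ lam2 f hf.1 heven hswap
  have hQP := sum_piR_C0fn L hf.1
  have hPf := piNormOneLoop_holds L f heven
  have hBf := btermOneLoop_holds L f heven
  have hAf := axhatOneLoop_holds L f heven
  have hQf := piC0OneLoop_holds L Δ lam2 f hf.1 heven
  have hCf := bcOneLoop_holds L Δ lam2 f hf.1 heven
  rw [nn_sum_swap] at hQf hCf
  -- express everything through the hatted values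
  have hV : ((L : ℝ) ^ 2) = 4 * Real.pi ^ 2 / θ ^ 2 := by rw [hθ]; field_simp; ring
  have eP : PiNormSq L f = vP / (θ ^ 4 * (4 * Real.pi ^ 2)) := by
    rw [hPf, hvP, hV, ← hθ]; field_simp
  have eB : Bterm L f = 6 * vB / (θ ^ 4 * (4 * Real.pi ^ 2)) := by
    rw [hBf, hvB, hV, ← hθ]; field_simp
  have eA : Axhat L f = vA / (θ ^ 2 * (4 * Real.pi ^ 2)) := by
    rw [hAf, hvA, hV, ← hθ]; unfold cosx; field_simp
  have eQ : ∑ cc : Cfg L, piR L f cc * C0fn L Δ lam2 f cc = -(3 / 2) * vQ / (θ ^ 2 * (4 * Real.pi ^ 2)) := by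
    rw [hQf, hvQ, hV, ← hθ]; unfold nK
    simp only [List.sum_map_mul_right]
    field_simp
  have eC : BCterm L Δ lam2 f = -3 * vJ / (θ ^ 2 * (4 * Real.pi ^ 2)) := by
    rw [hCf, hvJ, hV, ← hθ]; unfold bcJ bcSummand; field_simp
  have hPpos : 0 < PiNormSq L f := by rw [eP]; positivity
  have hT : Tplus L Δ f = 3 * lam2 + (∑ cc : Cfg L, piR L f cc * C0fn L Δ lam2 f cc) / PiNormSq L f := by
    rw [hQP]; field_simp; ring
  have hNval : trialGapN1 L Δ f = N1pE.eval y / (4 * Real.pi ^ 2 * θ ^ 2) := by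
    rw [eN, y0, y1, y2, y3, y4, y5, y6, y7, y8, y9, hX0, hX1, hX2, hX3, hX16, ← d7, ← d3, hN1, hG2, hT, eQ, eP, eB, eA, eC]
    field_simp
    ring
  have hUval : Uunit L Δ f = UpE.eval y / (4 * Real.pi ^ 2 * θ ^ 2) := by
    unfold Uunit
    rw [eU, y1, y2, y6, y8, hX1, hX2, hT, eQ, eP, hV]
    field_simp
    ring
  rw [hNval, hUval, mul_div_assoc']
  exact div_le_div_of_nonneg_right hM (by positivity)


/-! ## The parts decomposition of the ten bracket ends (each part = one kernel check on the literal staged box) -/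

/-- the 22 part data of a cell: `B̂` core/tail, `Â` core/tail, `P̂` main/tail, `Q̂₁` zero/block⁺/block⁻/outer/tail,
`Ĵ₁` special pairs (±), block pairs (± × two chunks), outer, tail (two chunks). -/
structure PD where
  /-- `B2coreC 2` -/
  dBc : SD
  /-- `B2tail 2` -/
  dBt : SD
  /-- `A2core 2` -/
  dAc : SD
  /-- `A2tail 2` -/
  dAt : SD
  /-- the four leading summands of `P2lo/P2hi` -/
  dPm : SD
  /-- the clipped tail of `P̂` -/
  dPt : SD
  /-- `Q1zero` -/
  dQz : SD
  /-- `Σ_block qBlockHi` -/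
  dQbh : SD
  /-- `Σ_block qBlockLo` -/
  dQbl : SD
  /-- `Q1outer 2` -/
  dQo : SD
  /-- `Q1tail 2` -/
  dQt : SD
  /-- `pair0Hi 3` -/
  dJp0h : SD
  /-- `pair0Lo 3` -/
  dJp0l : SD
  /-- `pairMHi 3` -/
  dJpMh : SD
  /-- `pairMLo 3` -/
  dJpMl : SD
  /-- block pairs, upper, first 14 -/
  dJbh1 : SD
  /-- block pairs, upper, rest -/
  dJbh2 : SD
  /-- block pairs, lower, first 14 -/
  dJbl1 : SD
  /-- block pairs, lower, rest -/
  dJbl2 : SD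
  /-- `J1outer 2` -/
  dJo : SD
  /-- `J1tail` summands 1, 2 -/
  dJt1 : SD
  /-- `J1tail` summands 4, 5 -/
  dJt2 : SD

/-- the part terms (as `RExpr`s), in the order of the fields of `PD`. -/
def pPmain : RExpr := rsum [cube F0h, rsum ((block1 2).map fun q => cube (Fh 3 q)), P2closedFull,
  .neg (rsum ((block1 2).map fun q => cube (ch 3 q)))]
/-- the clipped tail of `P̂`. -/
def pPtail : RExpr := .max (.sub P2tailFull (rsum ((block1 2).map fun q => P2tailAt 3 q))) (cst 0)
/-- `Σ_block qBlockHi`. -/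
def pQbh : RExpr := rsum ((block1 2).map fun q => qBlockHi 3 q)
/-- `Σ_block qBlockLo`. -/
def pQbl : RExpr := rsum ((block1 2).map fun q => qBlockLo 3 q)
/-- block pairs, upper, first chunk. -/
def pJbh1 : RExpr := rsum (((blockP 2).take 14).map fun q => pairHi 3 q)
/-- block pairs, upper, second chunk. -/
def pJbh2 : RExpr := rsum (((blockP 2).drop 14).map fun q => pairHi 3 q)
/-- block pairs, lower, first chunk. -/
def pJbl1 : RExpr := rsum (((blockP 2).take 14).map fun q => pairLo 3 q)
/-- block pairs, lower, second chunk. -/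
def pJbl2 : RExpr := rsum (((blockP 2).drop 14).map fun q => pairLo 3 q)
/-- `J1tail` summands 1, 2. -/
def pJt1 : RExpr := rsum [ .max (.sub (J1t1Full 3) (rsum ((blockP 2).map fun q => J1t1At 3 q))) (cst 0),
  .max (.sub (J1t2Full 3) (rsum ((blockP 2).map fun q => J1t2At 3 q))) (cst 0) ]
/-- `J1tail` summands 4, 5. -/
def pJt2 : RExpr := rsum [ .max (.sub (J1t4Full 3) (rsum ((blockP 2).map fun q => J1t4At 3 q))) (cst 0),
  .max (.sub (J1t5Full 3) (rsum ((blockP 2).map fun q => J1t5At 3 q))) (cst 0) ]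

/-- ★ the ten end data assembled from the part data (the exact `SD` terms the final check evaluates). -/
def endsOfParts (p : ℕ) (d : PD) : List (SD × SD) :=
  let dJt := d.dJt1.add p d.dJt2
  [(d.dBc.sub p d.dBt, d.dBc.add p d.dBt), (d.dPm.add p d.dPt.neg, d.dPm.add p d.dPt), (d.dAc.sub p d.dAt, d.dAc.add p d.dAt),
   (d.dQz.add p (d.dQbl.add p (d.dQo.add p d.dQt.neg)), d.dQz.add p (d.dQbh.add p (d.dQo.add p d.dQt))),
   (d.dJp0l.add p (d.dJpMl.add p ((d.dJbl1.add p d.dJbl2).add p (d.dJo.add p dJt.neg))),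
    d.dJp0h.add p (d.dJpMh.add p ((d.dJbh1.add p d.dJbh2).add p (d.dJo.add p dJt))))]

/-- ★ ALL PART CHECKS of a cell on its literal staged box `B`. -/
structure PartsOK (B : Box) (pi : ℕ × ℕ) (d : PD) : Prop where
  /-- `B2coreC` -/ hBc : endCheckB B pi (B2coreC 2) d.dBc = true
  /-- `B2tail` -/ hBt : endCheckB B pi (B2tail 2) d.dBt = true
  /-- `A2core` -/ hAc : endCheckB B pi (A2core 2) d.dAc = true
  /-- `A2tail` -/ hAt : endCheckB B pi (A2tail 2) d.dAt = true
  /-- `P` main -/ hPm : endCheckB B pi pPmain d.dPm = true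
  /-- `P` tail -/ hPt : endCheckB B pi pPtail d.dPt = true
  /-- `Q1zero` -/ hQz : endCheckB B pi Q1zero d.dQz = true
  /-- `Q` block⁺ -/ hQbh : endCheckB B pi pQbh d.dQbh = true
  /-- `Q` block⁻ -/ hQbl : endCheckB B pi pQbl d.dQbl = true
  /-- `Q1outer` -/ hQo : endCheckB B pi (Q1outer 2) d.dQo = true
  /-- `Q1tail` -/ hQt : endCheckB B pi (Q1tail 2) d.dQt = true
  /-- `pair0Hi` -/ hJp0h : endCheckB B pi (pair0Hi 3) d.dJp0h = true
  /-- `pair0Lo` -/ hJp0l : endCheckB B pi (pair0Lo 3) d.dJp0l = true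
  /-- `pairMHi` -/ hJpMh : endCheckB B pi (pairMHi 3) d.dJpMh = true
  /-- `pairMLo` -/ hJpMl : endCheckB B pi (pairMLo 3) d.dJpMl = true
  /-- `J` block⁺ 1 -/ hJbh1 : endCheckB B pi pJbh1 d.dJbh1 = true
  /-- `J` block⁺ 2 -/ hJbh2 : endCheckB B pi pJbh2 d.dJbh2 = true
  /-- `J` block⁻ 1 -/ hJbl1 : endCheckB B pi pJbl1 d.dJbl1 = true
  /-- `J` block⁻ 2 -/ hJbl2 : endCheckB B pi pJbl2 d.dJbl2 = true
  /-- `J1outer` -/ hJo : endCheckB B pi (J1outer 2) d.dJo = true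
  /-- `J` tail 1 -/ hJt1 : endCheckB B pi pJt1 d.dJt1 = true
  /-- `J` tail 2 -/ hJt2 : endCheckB B pi pJt2 d.dJt2 = true

/-- ★★ the part checks give the ten end conditions of the assembled ends. -/
theorem ends_of_parts {c : L2.NamedCell} {a1 a2 : ℚ} {pi : ℕ × ℕ} {B : Box} {d : PD}
    (hbox : cellBox c a1 a2 2 pi = some B) (h : PartsOK B pi d) :
    ∀ j (hj : j < (objSpecsC 2).length) (hj' : j < (endsOfParts pi.1 d).length),
      EndHolds c a1 a2 2 pi ((objSpecsC 2)[j].1) ((endsOfParts pi.1 d)[j].1) ∧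
      EndHolds c a1 a2 2 pi ((objSpecsC 2)[j].2) ((endsOfParts pi.1 d)[j].2) := by
  have E := fun {e : RExpr} {D : SD} (hh : endCheckB B pi e D = true) => endHolds_of_checkB hbox hh
  -- the assembled ends
  have hB1 : EndHolds c a1 a2 2 pi (B2loC 2) (d.dBc.sub pi.1 d.dBt) := endHolds_sub pi.1 (E h.hBc) (E h.hBt)
  have hB2 : EndHolds c a1 a2 2 pi (B2hiC 2) (d.dBc.add pi.1 d.dBt) := endHolds_add pi.1 (E h.hBc) (E h.hBt)
  have hA1 : EndHolds c a1 a2 2 pi (A2lo 2) (d.dAc.sub pi.1 d.dAt) := endHolds_sub pi.1 (E h.hAc) (E h.hAt)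
  have hA2 : EndHolds c a1 a2 2 pi (A2hi 2) (d.dAc.add pi.1 d.dAt) := endHolds_add pi.1 (E h.hAc) (E h.hAt)
  have hP1 : EndHolds c a1 a2 2 pi (P2lo 2) (d.dPm.add pi.1 d.dPt.neg) :=
    endHolds_append pi.1 _ [_] (E h.hPm) (endHolds_neg (E h.hPt))
  have hP2 : EndHolds c a1 a2 2 pi (P2hi 2) (d.dPm.add pi.1 d.dPt) := endHolds_append pi.1 _ [_] (E h.hPm) (E h.hPt)
  have hQ1 : EndHolds c a1 a2 2 pi (Q1lo 2) (d.dQz.add pi.1 (d.dQbl.add pi.1 (d.dQo.add pi.1 d.dQt.neg))) :=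
    endHolds_cons pi.1 (E h.hQz) (endHolds_cons pi.1 (E h.hQbl) (endHolds_cons pi.1 (E h.hQo)
      (endHolds_single (endHolds_neg (E h.hQt)))))
  have hQ2 : EndHolds c a1 a2 2 pi (Q1hi 2) (d.dQz.add pi.1 (d.dQbh.add pi.1 (d.dQo.add pi.1 d.dQt))) :=
    endHolds_cons pi.1 (E h.hQz) (endHolds_cons pi.1 (E h.hQbh) (endHolds_cons pi.1 (E h.hQo) (endHolds_single (E h.hQt))))
  have hJt : EndHolds c a1 a2 2 pi (J1tail 2) (d.dJt1.add pi.1 d.dJt2) := endHolds_append pi.1 _ _ (E h.hJt1) (E h.hJt2)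
  have hJbh : EndHolds c a1 a2 2 pi (rsum ((blockP 2).map fun q => pairHi 3 q)) (d.dJbh1.add pi.1 d.dJbh2) :=
    endHolds_chunks pi.1 (blockP 2) _ 14 (E h.hJbh1) (E h.hJbh2)
  have hJbl : EndHolds c a1 a2 2 pi (rsum ((blockP 2).map fun q => pairLo 3 q)) (d.dJbl1.add pi.1 d.dJbl2) :=
    endHolds_chunks pi.1 (blockP 2) _ 14 (E h.hJbl1) (E h.hJbl2)
  have hJ1 : EndHolds c a1 a2 2 pi (J1lo 2)
      (d.dJp0l.add pi.1 (d.dJpMl.add pi.1 ((d.dJbl1.add pi.1 d.dJbl2).add pi.1 (d.dJo.add pi.1 (d.dJt1.add pi.1 d.dJt2).neg)))) :=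
    endHolds_cons pi.1 (E h.hJp0l) (endHolds_cons pi.1 (E h.hJpMl) (endHolds_cons pi.1 hJbl (endHolds_cons pi.1 (E h.hJo)
      (endHolds_single (endHolds_neg hJt)))))
  have hJ2 : EndHolds c a1 a2 2 pi (J1hi 2)
      (d.dJp0h.add pi.1 (d.dJpMh.add pi.1 ((d.dJbh1.add pi.1 d.dJbh2).add pi.1 (d.dJo.add pi.1 (d.dJt1.add pi.1 d.dJt2))))) :=
    endHolds_cons pi.1 (E h.hJp0h) (endHolds_cons pi.1 (E h.hJpMh) (endHolds_cons pi.1 hJbh (endHolds_cons pi.1 (E h.hJo)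
      (endHolds_single hJt))))
  intro j hj hj'
  have hj5 : j < 5 := by simpa [objSpecsC] using hj
  interval_cases j
  · exact ⟨by simpa [objSpecsC, endsOfParts] using hB1, by simpa [objSpecsC, endsOfParts] using hB2⟩
  · exact ⟨by simpa [objSpecsC, endsOfParts] using hP1, by simpa [objSpecsC, endsOfParts] using hP2⟩
  · exact ⟨by simpa [objSpecsC, endsOfParts] using hA1, by simpa [objSpecsC, endsOfParts] using hA2⟩
  · exact ⟨by simpa [objSpecsC, endsOfParts] using hQ1, by simpa [objSpecsC, endsOfParts] using hQ2⟩
  · exact ⟨by simpa [objSpecsC, endsOfParts] using hJ1, by simpa [objSpecsC, endsOfParts] using hJ2⟩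

/-- ★★★ **THE FIRST-ORDER CELL CERTIFICATE**: the literal staged box IS the cell's box, the 22 part checks pass on it, and
the final check passes with the assembled ends ⟹ for EVERY `L ≥ 128` and EVERY ground two-magnon profile (`0 ≤ Δ < 1`)
with `ν = λ₂/θ² ∈ [n₁/νd, n₂/νd]`, `a = Δf(x̂) ∈ [a₁, a₂]`:  `cmin · U ≤ N₁`. -/
theorem trialGap_of_partsB (c : L2.NamedCell) (a1 a2 cmin : ℚ) (pi : ℕ × ℕ) (B : Box) (d : PD)
    (hbox : cellBox c a1 a2 2 pi = some B) (hparts : PartsOK B pi d)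
    (hfin : finalCheckB B pi (endsOfParts pi.1 d) cmin = true) (hc : c.check = true) (hL : 128 ≤ L)
    {Δ lam2 : ℝ} {f : Tor L → ℝ} (hΔ0 : 0 ≤ Δ) (hΔ1 : Δ < 1) (hf : IsGroundTwoMagnon L Δ lam2 f)
    (hν1 : (c.n1 : ℝ) / c.νd ≤ lam2 / (2 * Real.pi / L) ^ 2) (hν2 : lam2 / (2 * Real.pi / L) ^ 2 ≤ (c.n2 : ℝ) / c.νd)
    (ha1 : ((a1 : ℚ) : ℝ) ≤ Δ * f (K1 L)) (ha2 : Δ * f (K1 L) ≤ ((a2 : ℚ) : ℝ)) :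
    (cmin : ℝ) * Uunit L Δ f ≤ trialGapN1 L Δ f :=
  trialGap_of_coreBound L c a1 a2 cmin
    (coreBound_of_cellCheckS (pi := pi) (endsOfParts pi.1 d) (by simp [objSpecsC, endsOfParts]) (ends_of_parts hbox hparts)
      (finalCheckS_of_B hbox hfin)) hc hL hΔ0 hΔ1 hf hν1 hν2 ha1 ha2

/-- ★★★ **EIGHT PASSING END CHECKS, THE TWO `Ĵ₁` END CONDITIONS (`endHolds_J1lo/J1hi` from five part checks each) AND A
PASSING FINAL CHECK GIVE THE TRIAL-GAP BOUND FOR EVERY `L ≥ 128` ON THE CELL** (the first-order cell certificate;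
`pi = (prec, Heron steps)`). -/
theorem trialGap_of_cellCheckS2 (c : L2.NamedCell) (a1 a2 cmin : ℚ) (pi : ℕ × ℕ)
    (dBlo dBhi dPlo dPhi dAlo dAhi dQlo dQhi dJlo dJhi : SD)
    (hBlo : endCheckS c a1 a2 2 pi (B2loC 2) dBlo = true) (hBhi : endCheckS c a1 a2 2 pi (B2hiC 2) dBhi = true)
    (hPlo : endCheckS c a1 a2 2 pi (P2lo 2) dPlo = true) (hPhi : endCheckS c a1 a2 2 pi (P2hi 2) dPhi = true)
    (hAlo : endCheckS c a1 a2 2 pi (A2lo 2) dAlo = true) (hAhi : endCheckS c a1 a2 2 pi (A2hi 2) dAhi = true)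
    (hQlo : endCheckS c a1 a2 2 pi (Q1lo 2) dQlo = true) (hQhi : endCheckS c a1 a2 2 pi (Q1hi 2) dQhi = true)
    (hJlo : EndHolds c a1 a2 2 pi (J1lo 2) dJlo) (hJhi : EndHolds c a1 a2 2 pi (J1hi 2) dJhi)
    (hfin : finalCheckS c a1 a2 2 pi [(dBlo, dBhi), (dPlo, dPhi), (dAlo, dAhi), (dQlo, dQhi), (dJlo, dJhi)] cmin = true)
    (hc : c.check = true) (hL : 128 ≤ L)
    {Δ lam2 : ℝ} {f : Tor L → ℝ} (hΔ0 : 0 ≤ Δ) (hΔ1 : Δ < 1) (hf : IsGroundTwoMagnon L Δ lam2 f)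
    (hν1 : (c.n1 : ℝ) / c.νd ≤ lam2 / (2 * Real.pi / L) ^ 2) (hν2 : lam2 / (2 * Real.pi / L) ^ 2 ≤ (c.n2 : ℝ) / c.νd)
    (ha1 : ((a1 : ℚ) : ℝ) ≤ Δ * f (K1 L)) (ha2 : Δ * f (K1 L) ≤ ((a2 : ℚ) : ℝ)) :
    (cmin : ℝ) * Uunit L Δ f ≤ trialGapN1 L Δ f :=
  trialGap_of_coreBound L c a1 a2 cmin
    (coreBound_of_cellCheckS (pi := pi) [(dBlo, dBhi), (dPlo, dPhi), (dAlo, dAhi), (dQlo, dQhi), (dJlo, dJhi)]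
      (by simp [objSpecsC]) (fun j hj hj' => by
        have hj5 : j < 5 := by simpa [objSpecsC] using hj
        interval_cases j
        · exact ⟨by simpa [objSpecsC] using endHolds_of_check hBlo, by simpa [objSpecsC] using endHolds_of_check hBhi⟩
        · exact ⟨by simpa [objSpecsC] using endHolds_of_check hPlo, by simpa [objSpecsC] using endHolds_of_check hPhi⟩
        · exact ⟨by simpa [objSpecsC] using endHolds_of_check hAlo, by simpa [objSpecsC] using endHolds_of_check hAhi⟩
        · exact ⟨by simpa [objSpecsC] using endHolds_of_check hQlo, by simpa [objSpecsC] using endHolds_of_check hQhi⟩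
        · exact ⟨by simpa [objSpecsC] using hJlo, by simpa [objSpecsC] using hJhi⟩) hfin)
    hc hL hΔ0 hΔ1 hf hν1 hν2 ha1 ha2

end Summit.HubbardSuperconductivity.HubbardSuperconductivity.Theorems.AnisotropyChord.Transfer.Fibre3.L2.N1
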